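import Mathlib.Analysis.InnerProductSpace.PiL2
import Mathlib.Geometry.Euclidean.Angle.Unoriented.TriangleInequality
import Mathlib.Geometry.Euclidean.Triangle
import Mathlib.LinearAlgebra.Matrix.Determinant.Basic
import Mathlib.Tactic.Module
import HarnessLib

/-!
# The perimeter of a convex spherical polygon is less than `2π` (Euclid XI.21) — proved:
# the metric content of Musin–Tarasov's Proposition 3.4 and of Hales's hexagon argument

Topic `Literature/Geometry/DiscreteGeometry`; brick 6, in printed order, of the proof of
Theorem 1 of O. R. Musin, A. S. Tarasov, *The strong thirteen spheres problem*, Discrete Comput.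
Geom. 48 (2012) 128–141 [`MusinTarasov2012`] (named fact `musinTarasov2012_tammes_thirteen`,
file `TammesThirteen.lean`), after `SphericalCodeContactGraph.lean` (Propositions 3.1, 3.3,
3.7), `SphericalCodeOptimal.lean` (§2.1), `RankinOrthoplexBound.lean`,
`SphericalCodeIrreducible.lean` (Propositions 3.2–3.3), `SphericalCodeVertexStar.lean`
(Proposition 3.6), `SphericalRhombus.lean` (Proposition 3.8) and `SphericalCodeHullEdges.lean`.
Everything in this file is a definition or PROVED; there are no named facts.

## Source (verbatim, arXiv:1002.1439v3)

§3.1, p. 5: "**Proposition 3.4.** Let `X ⊂ S²` with `|X| = N`. If the graph `CG(X)` is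
irreducible, then its faces are polygons with at most `⌊2π/d_N⌋` vertices."  (The proof is not
printed: "The following three propositions are proved in [Dan] (also see [FeT], [BS,BS14])".)
"**Corollary 3.1.** […] Any face of `G₁₃` is a polygon with `3, 4, 5` or `6` vertices".
§3.2: "Note that all faces of `CG(X)` are convex polygons. (Otherwise, a 'concave' vertex of a
polygon `P` can be shifted to the interior of `P`.) Then the faces of the graph `CG(X)` in `S²`
are regular triangles, rhombi, convex equilateral pentagons, and convex equilateral hexagons.
Polygons with more than six vertices cannot occur. […] The lengths of all edges of `CG(X)`
equal `ψ(X)`."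

The inequality behind Proposition 3.4 is the classical one formalised here: **the perimeter of
a convex spherical polygon is less than `2π`** — equivalently Euclid, *Elements* XI.21, "any
solid angle is contained by plane angles less than four right angles" — so that a convex face
with `m` sides, all of length `d_N`, has `m · d_N < 2π`, i.e. `m ≤ ⌊2π/d_N⌋` (`= 6` for
`51.43° < d_N < 60°`, in particular for `d₁₃ ≈ 57.1367°`).  The same inequality is Hales's
"geometrical argument" in the proof of Lemma 9 of *A proof of Fejes Tóth's conjecture on sphere
packings with kissing number twelve* (arXiv:1209.6043, [`Hales2012`]): "the perimeter of a
hexagon with sides `π/3` is `2π`. However, the hexagons are geodesically convex, and `2π` is a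
strict upper bound on the perimeter of the hexagon. Thus, this case does not exist."  (The file
`TameContactGraphs.lean` had to replace that step by an ad-hoc algebraic computation, this
inequality being absent from Mathlib.)

## What is proved, and in which form

* Part A (any real inner product space `V`; Euclid's argument): for a closed polygon
  `A 0, …, A (n−1)` (a periodic sequence of points) and an apex `0`,
  `polygon_angle_sum` — the angle sum `(n − 2)π` of a planar convex polygon, from the fan of
  triangles at one vertex (hypotheses: the additivity of angles along the fan, stated as
  membership in planar cones `Submodule.span ℝ≥0 {·, ·}`), and
  **`sum_angle_lt_two_pi_core`** — `Σ_{i<n} ∠(A i, A (i+1)) < 2π` at the apex, from the angle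
  sum `π` of the triangles `0, A i, A (i+1)` (`EuclideanGeometry.angle_add_angle_add_angle_eq_pi`),
  the trihedral inequality `∠ A(i−1) A i A(i+1) ≤ ∠ A(i−1) A i 0 + ∠ 0 A i A(i+1)`
  (`EuclideanGeometry.angle_le_angle_add_angle`, strict at one vertex) and Part A.
* Part B (`ℝ³`): `orient3 u v w` — the `3 × 3` determinant of the coordinates (scalar triple
  product; `orient3_eq_det`) — with its ring identities, notably the expansion
  `orient3_expand : det[a;b;c] • w = det[w;b;c] • a + det[a;w;c] • b + det[a;b;w] • c`, and the
  linear functional `orient3Right a b = det[a; b; ·]`.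
* Part C (`ℝ³`, the gnomonic projection `X ↦ X/φ(X)` onto a plane `φ = 1`):
  `proj_sub_proj_mem_span` (orientation signs give the planar-cone memberships of Part A),
  `angle_lt_angle_add_angle_of_orient3` (the trihedral inequality is strict off the plane),
  `ne_smul_of_orient3_pos`.
* Part D, the theorem: **`sum_angle_lt_two_pi_of_orient3_pos`** — if `v 0, …, v (n−1) ∈ ℝ³`
  (`n ≥ 3`) have ALL CYCLICALLY ORDERED TRIPLES POSITIVELY ORIENTED, `det[v i; v j; v k] > 0`
  for `i < j < k` (the standard certificate that the rays `ℝ₊ v i` are, in this order, the edges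
  of a convex polyhedral angle, i.e. that the points `v i/‖v i‖` are, in this order, the
  vertices of a strictly convex spherical polygon), then
  `Σ_{i<n−1} ∠(v i, v (i+1)) + ∠(v (n−1), v 0) < 2π`; here `∠ = InnerProductGeometry.angle` is
  the spherical distance.  (A functional positive on all `v i` is
  `det[v 0; v 1; ·] + det[v 1; v 2; ·] + det[v (n−1); v 0; ·]`; the hypotheses of Part A are then
  read off the orientation signs by Part C.)  Variants: `…_of_orient3_neg` (clockwise order),
  `sum_angle_finRotate_lt_two_pi` (`Fin n`-indexed).
* Part E, corollaries: `card_mul_lt_two_pi_of_le_angle` (all sides `≥ d` ⇒ `n·d < 2π`),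
  `card_lt_two_pi_div_of_le_angle`, **`card_le_floor_two_pi_div_of_le_angle`** (`n ≤ ⌊2π/d⌋`,
  the numerical content of Proposition 3.4), `card_le_six_of_le_angle` (`d > 2π/7 ⇒ n ≤ 6`,
  Corollary 3.1 (iii) range) and `card_le_five_of_pi_div_three_le_angle` (Hales's hexagon:
  sides `≥ π/3 ⇒ n ≤ 5`).

Not here: the FACES of a contact graph (which gaps at which vertices bound a common face, and
that a face is a convex spherical polygon in the above sense) — this needs the global structure
of the contact fan (planarity/Euler), cf. the module docstring of `SphericalCodeVertexStar.lean`;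
so Proposition 3.4 as a statement about `CG(X)` is not formalised, only its metric content.

## References

* O. R. Musin, A. S. Tarasov, Discrete Comput. Geom. 48 (2012) 128–141 = arXiv:1002.1439,
  §3.1 Proposition 3.4, Corollary 3.1, §3.2. [`MusinTarasov2012`]
* T. C. Hales, *A proof of Fejes Tóth's conjecture on sphere packings with kissing number
  twelve*, arXiv:1209.6043 (2012), proof of Lemma 9. [`Hales2012`]
* Euclid, *Elements*, Book XI, Proposition 21 (T. L. Heath ed., vol. 3). [folklore]
-/

noncomputable section

open Real RealInnerProductSpace InnerProductGeometry Finset NNReal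
open scoped EuclideanGeometry

namespace Literature.Geometry.DiscreteGeometry

local notation "E3" => EuclideanSpace ℝ (Fin 3)

section Core

variable {V : Type*} [NormedAddCommGroup V] [InnerProductSpace ℝ V]

/-- Additivity of angles at a point: if `p₂ - p` lies in the closed planar cone at `p` spanned by
`p₁ - p` and `p₃ - p`, then `∠ p₁ p p₃ = ∠ p₁ p p₂ + ∠ p₂ p p₃`. [folklore] -/
theorem angle_eq_angle_add_angle_of_mem_span {p p₁ p₂ p₃ : V} (h₂ : p₂ ≠ p)
    (hmem : p₂ - p ∈ Submodule.span ℝ≥0 {p₁ - p, p₃ - p}) :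
    ∠ p₁ p p₃ = ∠ p₁ p p₂ + ∠ p₂ p p₃ := by
  simp only [EuclideanGeometry.angle, vsub_eq_sub]
  exact angle_eq_angle_add_add_angle_add_of_mem_span (sub_ne_zero.2 h₂) hmem

/-- The angle at the apex `0`: `∠ x 0 z = angle x z`. [folklore] -/
theorem angle_zero_mid (x z : V) : ∠ x (0 : V) z = InnerProductGeometry.angle x z := by
  simp [EuclideanGeometry.angle]

/-- A periodic shift of a finite sum: if `f 0 = f n` then `Σ_{i<n} f i = Σ_{i<n} f (i+1)`.
[folklore] -/
theorem sum_range_succ_shift (f : ℕ → ℝ) (n : ℕ) (h : f 0 = f n) :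
    ∑ i ∈ range n, f i = ∑ i ∈ range n, f (i + 1) := by
  have h1 : ∑ i ∈ range (n + 1), f i = ∑ i ∈ range n, f (i + 1) + f 0 := sum_range_succ' f n
  rw [sum_range_succ, ← h] at h1
  linarith

/-- **The fan angle sum.**  For points `A 1, …, A (m+2)` seen from `A n` (all distinct from it),
with each `A k - A n` (`2 ≤ k ≤ m+1`) in the planar cone at `A n` spanned by `A 1 - A n` and
`A (k+1) - A n`, the angles `∠ A(k+1), A n, A(k+2)` (`k < m+1`) add up to `∠ A 1, A n, A (m+2)`.
[folklore] -/
theorem fan_angle_sum (A : ℕ → V) (n m : ℕ)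
    (hfan : ∀ k, 2 ≤ k → k ≤ m + 1 → A k - A n ∈ Submodule.span ℝ≥0 {A 1 - A n, A (k + 1) - A n})
    (hne : ∀ k, 2 ≤ k → k ≤ m + 1 → A k ≠ A n) :
    ∑ k ∈ range (m + 1), ∠ (A (k + 1)) (A n) (A (k + 2)) = ∠ (A 1) (A n) (A (m + 2)) := by
  induction m with
  | zero => simp
  | succ m ih =>
    rw [sum_range_succ, ih (fun k hk hk' => hfan k hk (by omega))
      (fun k hk hk' => hne k hk (by omega))]
    exact (angle_eq_angle_add_angle_of_mem_span (hne (m + 2) (by omega) (by omega))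
      (hfan (m + 2) (by omega) (by omega))).symm

/-- **The angle sum of a convex planar polygon is `(n − 2)π`**, in the form used here: for a
sequence of points `A` with `A (m+3) = A 0`, `A (m+4) = A 1` (period `n = m + 3`), pairwise
distinct on a period, such that the fan from the vertex `A n = A 0` is additive (hypotheses
`hfan`: `A k` is inside the angle `A 1, A n, A (k+1)`; `hmid`: `A n` is inside the angle
`A (k-1), A k, A (k+1)`), one has `Σ_{i<n} ∠ A i, A (i+1), A (i+2) = (n − 2) π`. [folklore] -/
theorem polygon_angle_sum (A : ℕ → V) (m : ℕ) (hper0 : A (m + 3) = A 0) (hper1 : A (m + 4) = A 1)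
    (hne : ∀ i j, i < j → j < m + 3 → A i ≠ A j)
    (hfan : ∀ k, 2 ≤ k → k ≤ m + 1 →
      A k - A (m + 3) ∈ Submodule.span ℝ≥0 {A 1 - A (m + 3), A (k + 1) - A (m + 3)})
    (hmid : ∀ k, 2 ≤ k → k ≤ m + 1 →
      A (m + 3) - A k ∈ Submodule.span ℝ≥0 {A (k - 1) - A k, A (k + 1) - A k}) :
    ∑ i ∈ range (m + 3), ∠ (A i) (A (i + 1)) (A (i + 2)) = (m + 1) * π := by
  have hneN : ∀ k, 1 ≤ k → k ≤ m + 2 → A k ≠ A (m + 3) := by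
    intro k hk hk'
    rw [hper0]
    exact (hne 0 k (by omega) (by omega)).symm
  -- the triangles (A n, A (k+1), A (k+2)), k < m + 1
  have htri : ∀ k ∈ range (m + 1),
      ∠ (A (m + 3)) (A (k + 1)) (A (k + 2)) + ∠ (A (k + 1)) (A (k + 2)) (A (m + 3))
        + ∠ (A (k + 2)) (A (m + 3)) (A (k + 1)) = π := by
    intro k hk
    rw [mem_range] at hk
    exact EuclideanGeometry.angle_add_angle_add_angle_eq_pi (A (k + 2))
      (hneN (k + 1) (by omega) (by omega))
  have hsumtri : ∑ k ∈ range (m + 1), (∠ (A (m + 3)) (A (k + 1)) (A (k + 2))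
      + ∠ (A (k + 1)) (A (k + 2)) (A (m + 3)) + ∠ (A (k + 2)) (A (m + 3)) (A (k + 1)))
      = (m + 1) * π := by
    rw [sum_congr rfl htri]
    simp
  -- the fan at the vertex `A n`
  have hfan_sum : ∑ k ∈ range (m + 1), ∠ (A (k + 2)) (A (m + 3)) (A (k + 1))
      = ∠ (A (m + 2)) (A (m + 3)) (A 1) := by
    rw [EuclideanGeometry.angle_comm (A (m + 2))]
    rw [← fan_angle_sum A (m + 3) m hfan (fun k hk hk' => hneN k (by omega) (by omega))]
    exact sum_congr rfl fun k _ => EuclideanGeometry.angle_comm _ _ _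
  -- split the polygon sum: i = 0, middle i = 1..m, i = m+1, i = m+2
  have hsplit : ∑ i ∈ range (m + 3), ∠ (A i) (A (i + 1)) (A (i + 2))
      = ∠ (A 0) (A 1) (A 2) + ∑ i ∈ range m, ∠ (A (i + 1)) (A (i + 2)) (A (i + 3))
        + ∠ (A (m + 1)) (A (m + 2)) (A (m + 3)) + ∠ (A (m + 2)) (A (m + 3)) (A (m + 4)) := by
    rw [sum_range_succ, sum_range_succ, sum_range_succ']
    simp only [add_assoc, Nat.reduceAdd, zero_add]
    ring
  -- middle vertices: additivity at A (i+2)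
  have hmid' : ∀ i ∈ range m, ∠ (A (i + 1)) (A (i + 2)) (A (i + 3))
      = ∠ (A (i + 1)) (A (i + 2)) (A (m + 3)) + ∠ (A (m + 3)) (A (i + 2)) (A (i + 3)) := by
    intro i hi
    rw [mem_range] at hi
    have h := hmid (i + 2) (by omega) (by omega)
    have h2 : A (m + 3) ≠ A (i + 2) := (hneN (i + 2) (by omega) (by omega)).symm
    exact angle_eq_angle_add_angle_of_mem_span h2 (by simpa using h)
  -- the pieces
  have hR : ∑ k ∈ range (m + 1), ∠ (A (m + 3)) (A (k + 1)) (A (k + 2))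
      = ∠ (A (m + 3)) (A 1) (A 2) + ∑ i ∈ range m, ∠ (A (m + 3)) (A (i + 2)) (A (i + 3)) := by
    rw [sum_range_succ']
    simp only [add_assoc, Nat.reduceAdd, zero_add]
    ring
  have hL : ∑ k ∈ range (m + 1), ∠ (A (k + 1)) (A (k + 2)) (A (m + 3))
      = ∑ i ∈ range m, ∠ (A (i + 1)) (A (i + 2)) (A (m + 3))
        + ∠ (A (m + 1)) (A (m + 2)) (A (m + 3)) := by
    rw [sum_range_succ]
  rw [hsplit, sum_congr rfl hmid', sum_add_distrib, hper1, ← hfan_sum, ← hper0, ← hsumtri,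
    sum_add_distrib, sum_add_distrib, hR, hL]
  ring

/-- **Euclid XI.21, core form (any real inner product space).**  Let `A` be a sequence of nonzero
points with `A (m+3) = A 0`, `A (m+4) = A 1`, pairwise distinct on a period, whose "polygon"
`A 0, A 1, …, A (m+2)` is convex in the sense of `polygon_angle_sum` (`hfan`, `hmid`) and such
that at the vertex `A 1` the trihedral inequality with apex `0` is strict.  Then the angles
subtended at `0` by the sides satisfy `Σ_{i<n} angle (A i) (A (i+1)) < 2π`.  This is the
classical argument of Euclid, *Elements* XI.21 ("any solid angle is contained by plane angles
less than four right angles"): the angle sum `π` of each triangle `0, A i, A (i+1)`, the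
trihedral inequality `∠ A(i-1) A i A(i+1) ≤ ∠ A(i-1) A i 0 + ∠ 0 A i A(i+1)` at each vertex,
and the angle sum `(n − 2)π` of the polygon. [folklore] -/
theorem sum_angle_lt_two_pi_core (A : ℕ → V) (m : ℕ) (hper0 : A (m + 3) = A 0)
    (hper1 : A (m + 4) = A 1) (hne : ∀ i j, i < j → j < m + 3 → A i ≠ A j)
    (hfan : ∀ k, 2 ≤ k → k ≤ m + 1 →
      A k - A (m + 3) ∈ Submodule.span ℝ≥0 {A 1 - A (m + 3), A (k + 1) - A (m + 3)})
    (hmid : ∀ k, 2 ≤ k → k ≤ m + 1 →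
      A (m + 3) - A k ∈ Submodule.span ℝ≥0 {A (k - 1) - A k, A (k + 1) - A k})
    (hstrict : ∠ (A 0) (A 1) (A 2) < ∠ (A 0) (A 1) 0 + ∠ 0 (A 1) (A 2)) :
    ∑ i ∈ range (m + 3), InnerProductGeometry.angle (A i) (A (i + 1)) < 2 * π := by
  have hne' : ∀ i, i < m + 3 → A (i + 1) ≠ A i := by
    intro i hi
    rcases Nat.lt_or_ge (i + 1) (m + 3) with h | h
    · exact (hne i (i + 1) (by omega) h).symm
    · have : i = m + 2 := by omega
      subst this
      rw [hper0]
      exact hne 0 (m + 2) (by omega) (by omega)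
  -- apex angle of the triangle (0, A i, A (i+1))
  have hapex : ∀ i ∈ range (m + 3), InnerProductGeometry.angle (A i) (A (i + 1))
      = π - ∠ (0 : V) (A i) (A (i + 1)) - ∠ (A i) (A (i + 1)) 0 := by
    intro i hi
    rw [mem_range] at hi
    have h := EuclideanGeometry.angle_add_angle_add_angle_eq_pi (0 : V) (hne' i hi)
    rw [angle_zero_mid, InnerProductGeometry.angle_comm (A (i + 1))] at h
    linarith
  rw [sum_congr rfl hapex, sum_sub_distrib, sum_sub_distrib]
  have hshift : ∑ i ∈ range (m + 3), ∠ (0 : V) (A i) (A (i + 1))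
      = ∑ i ∈ range (m + 3), ∠ (0 : V) (A (i + 1)) (A (i + 2)) := by
    refine sum_range_succ_shift (fun i => ∠ (0 : V) (A i) (A (i + 1))) (m + 3) ?_
    simp only [add_assoc, Nat.reduceAdd, hper0, hper1]
  rw [hshift]
  have hpoly := polygon_angle_sum A m hper0 hper1 hne hfan hmid
  have hle : ∑ i ∈ range (m + 3), ∠ (A i) (A (i + 1)) (A (i + 2))
      < ∑ i ∈ range (m + 3), (∠ (A i) (A (i + 1)) 0 + ∠ (0 : V) (A (i + 1)) (A (i + 2))) := by
    refine sum_lt_sum (fun i _ => EuclideanGeometry.angle_le_angle_add_angle _ _ _ _)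
      ⟨0, by simp, ?_⟩
    simpa using hstrict
  rw [sum_add_distrib] at hle
  simp only [sum_const, card_range, nsmul_eq_mul, Nat.cast_add, Nat.cast_ofNat] at hpoly ⊢
  linarith

end Core

section Orient

/-- The orientation (scalar triple product, `3 × 3` determinant of the coordinates) of three
vectors of `ℝ³`: `orient3 u v w = det [u; v; w] = ⟪u × v, w⟫`. [folklore] -/
def orient3 (u v w : E3) : ℝ :=
  u 0 * (v 1 * w 2 - v 2 * w 1) - u 1 * (v 0 * w 2 - v 2 * w 0) + u 2 * (v 0 * w 1 - v 1 * w 0)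

/-- `orient3` is the determinant of the coordinate matrix. [folklore] -/
theorem orient3_eq_det (u v w : E3) :
    orient3 u v w = Matrix.det !![u 0, u 1, u 2; v 0, v 1, v 2; w 0, w 1, w 2] := by
  rw [Matrix.det_fin_three]
  simp [orient3]
  ring

/-- Invariance under cyclic permutation. [folklore] -/
theorem orient3_cyclic (u v w : E3) : orient3 u v w = orient3 v w u := by
  unfold orient3; ring

/-- Antisymmetry in the first two arguments. [folklore] -/
theorem orient3_swap_left (u v w : E3) : orient3 u v w = -orient3 v u w := by
  unfold orient3; ring

/-- Antisymmetry in the last two arguments. [folklore] -/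
theorem orient3_swap_right (u v w : E3) : orient3 u v w = -orient3 u w v := by
  unfold orient3; ring

/-- Antisymmetry in the outer two arguments. [folklore] -/
theorem orient3_swap_outer (u v w : E3) : orient3 u v w = -orient3 w v u := by
  unfold orient3; ring

/-- Vanishing on a repeated argument (positions 1, 2). [folklore] -/
@[simp] theorem orient3_self_left (u w : E3) : orient3 u u w = 0 := by
  unfold orient3; ring

/-- Vanishing on a repeated argument (positions 2, 3). [folklore] -/
@[simp] theorem orient3_self_right (u v : E3) : orient3 u v v = 0 := by
  unfold orient3; ring

/-- Vanishing on a repeated argument (positions 1, 3). [folklore] -/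
@[simp] theorem orient3_self_outer (u v : E3) : orient3 u v u = 0 := by
  unfold orient3; ring

/-- Linearity in the first argument (scalars). [folklore] -/
@[simp] theorem orient3_smul_left (c : ℝ) (u v w : E3) :
    orient3 (c • u) v w = c * orient3 u v w := by
  unfold orient3; simp only [PiLp.smul_apply, smul_eq_mul]; ring

/-- Linearity in the second argument (scalars). [folklore] -/
@[simp] theorem orient3_smul_mid (c : ℝ) (u v w : E3) :
    orient3 u (c • v) w = c * orient3 u v w := by
  unfold orient3; simp only [PiLp.smul_apply, smul_eq_mul]; ring

/-- Linearity in the third argument (scalars). [folklore] -/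
@[simp] theorem orient3_smul_right (c : ℝ) (u v w : E3) :
    orient3 u v (c • w) = c * orient3 u v w := by
  unfold orient3; simp only [PiLp.smul_apply, smul_eq_mul]; ring

/-- Linearity in the third argument (sums). [folklore] -/
@[simp] theorem orient3_add_right (u v w w' : E3) :
    orient3 u v (w + w') = orient3 u v w + orient3 u v w' := by
  unfold orient3; simp only [PiLp.add_apply]; ring

/-- **Expansion of a fourth vector in three others** (Cramer's rule in `ℝ³`):
`det[a;b;c] • w = det[w;b;c] • a + det[a;w;c] • b + det[a;b;w] • c`. [folklore] -/
theorem orient3_expand (a b c w : E3) :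
    orient3 a b c • w = orient3 w b c • a + orient3 a w c • b + orient3 a b w • c := by
  ext i
  fin_cases i <;> simp [orient3] <;> ring

/-- `w ↦ orient3 a b w` as a linear functional on `ℝ³` (pairing with the cross product
`a × b`). [folklore] -/
def orient3Right (a b : E3) : E3 →ₗ[ℝ] ℝ where
  toFun := orient3 a b
  map_add' := orient3_add_right a b
  map_smul' c w := by simp

/-- Unfolding `orient3Right`. [folklore] -/
@[simp] theorem orient3Right_apply (a b w : E3) : orient3Right a b w = orient3 a b w := rfl

end Orient

section Gnomonic

/-- **The gnomonic (central) projection respects planar cones.**  Let `φ` be a linear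
functional positive on `P, Q, R, W ∈ ℝ³`, and project centrally onto the plane `φ = 1`
(`X ↦ (φ X)⁻¹ • X`).  If `det[P;Q;R] > 0`, `det[P;W;R] ≥ 0` and `det[P;Q;W] ≥ 0` (i.e. in the
basis `P, Q, R` the vector `W` has nonnegative `Q`- and `R`-coordinates), then the projection
of `W` lies in the closed planar angle at the projection of `P` spanned by the projections of
`Q` and `R`. [folklore] -/
theorem proj_sub_proj_mem_span (φ : E3 →ₗ[ℝ] ℝ) {P Q R W : E3} (hP : 0 < φ P) (hQ : 0 < φ Q)
    (hR : 0 < φ R) (hW : 0 < φ W) (hPQR : 0 < orient3 P Q R) (hPWR : 0 ≤ orient3 P W R)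
    (hPQW : 0 ≤ orient3 P Q W) :
    (φ W)⁻¹ • W - (φ P)⁻¹ • P ∈
      Submodule.span ℝ≥0 {(φ Q)⁻¹ • Q - (φ P)⁻¹ • P, (φ R)⁻¹ • R - (φ P)⁻¹ • P} := by
  have hexp := orient3_expand P Q R W
  have hφ : orient3 P Q R * φ W =
      orient3 W Q R * φ P + orient3 P W R * φ Q + orient3 P Q W * φ R := by
    have := congrArg φ hexp
    simpa only [map_add, map_smul, smul_eq_mul] using this
  rw [Submodule.mem_span_pair]
  have hα : 0 ≤ orient3 P W R * φ Q / (orient3 P Q R * φ W) := by positivity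
  have hγ : 0 ≤ orient3 P Q W * φ R / (orient3 P Q R * φ W) := by positivity
  refine ⟨Real.toNNReal (orient3 P W R * φ Q / (orient3 P Q R * φ W)),
    Real.toNNReal (orient3 P Q W * φ R / (orient3 P Q R * φ W)), ?_⟩
  simp only [NNReal.smul_def, Real.coe_toNNReal _ hα, Real.coe_toNNReal _ hγ]
  have hWexp : W =
      (orient3 P Q R)⁻¹ • (orient3 W Q R • P + orient3 P W R • Q + orient3 P Q W • R) := by
    rw [← hexp, inv_smul_smul₀ hPQR.ne']
  -- name the scalars
  generalize hD : orient3 P Q R = D at *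
  generalize ha : orient3 W Q R = a at *
  generalize hb : orient3 P W R = b at *
  generalize hc : orient3 P Q W = c at *
  generalize hp : φ P = p at *
  generalize hq : φ Q = q at *
  generalize hr : φ R = r at *
  generalize hs : φ W = s at *
  rw [hWexp]
  have hD0 : D ≠ 0 := hPQR.ne'
  have hs0 : s ≠ 0 := hW.ne'
  have hp0 : p ≠ 0 := hP.ne'
  have hq0 : q ≠ 0 := hQ.ne'
  have hr0 : r ≠ 0 := hR.ne'
  match_scalars
  · field_simp
  · field_simp
    linear_combination hφ
  · field_simp

/-- **Strict trihedral inequality off the plane.**  For three points `A₀, A₁, A₂` of the plane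
`φ = 1` with `det[A₀;A₁;A₂] ≠ 0`, the angle of the planar path at `A₁` is STRICTLY less than the
sum of the two face angles at `A₁` of the trihedral angle with apex `0`:
`∠ A₀ A₁ A₂ < ∠ A₀ A₁ 0 + ∠ 0 A₁ A₂`. [folklore] -/
theorem angle_lt_angle_add_angle_of_orient3 (φ : E3 →ₗ[ℝ] ℝ) {A₀ A₁ A₂ : E3} (h₀ : φ A₀ = 1)
    (h₁ : φ A₁ = 1) (h₂ : φ A₂ = 1) (hor : orient3 A₀ A₁ A₂ ≠ 0) :
    ∠ A₀ A₁ A₂ < ∠ A₀ A₁ 0 + ∠ 0 A₁ A₂ := by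
  have hA₁ : A₁ ≠ 0 := fun h => by simp [h] at h₁
  refine lt_of_le_of_ne (EuclideanGeometry.angle_le_angle_add_angle _ _ _ _) fun heq => ?_
  simp only [EuclideanGeometry.angle, vsub_eq_sub, zero_sub] at heq
  rw [angle_eq_angle_add_angle_iff (neg_ne_zero.2 hA₁)] at heq
  rcases heq with hpi | hmem
  · rw [angle_eq_pi_iff] at hpi
    obtain ⟨-, r, -, hr⟩ := hpi
    have hA₂ : A₂ = r • A₀ + (1 - r) • A₁ := by
      rw [sub_eq_iff_eq_add] at hr
      rw [hr]
      module
    apply hor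
    rw [hA₂, orient3_add_right, orient3_smul_right, orient3_smul_right, orient3_self_outer,
      orient3_self_right]
    ring
  · rw [Submodule.mem_span_pair] at hmem
    obtain ⟨s, t, hst⟩ := hmem
    have := congrArg φ hst
    simp only [NNReal.smul_def, map_add, map_smul, map_sub, map_neg, h₀, h₁, h₂, smul_eq_mul,
      sub_self, mul_zero, add_zero] at this
    norm_num at this

/-- Two of the vectors of a cyclically oriented family are never parallel. [folklore] -/
theorem ne_smul_of_orient3_pos {n : ℕ} (hn : 3 ≤ n) {v : ℕ → E3}
    (hv : ∀ i j k, i < j → j < k → k < n → 0 < orient3 (v i) (v j) (v k)) {i j : ℕ}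
    (hij : i < j) (hj : j < n) (c : ℝ) : v i ≠ c • v j := by
  intro h
  rcases Nat.lt_or_ge (j + 1) n with hj1 | hj1
  · have := hv i j (j + 1) hij (by omega) hj1
    rw [h, orient3_smul_left, orient3_self_left, mul_zero] at this
    exact lt_irrefl _ this
  · rcases Nat.eq_zero_or_pos i with hi | hi
    · subst hi
      have := hv 0 1 j (by omega) (by omega) hj
      rw [h, orient3_smul_left, orient3_self_outer, mul_zero] at this
      exact lt_irrefl _ this
    · have := hv 0 i j hi hij hj
      rw [h, orient3_smul_mid, orient3_self_right, mul_zero] at this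
      exact lt_irrefl _ this

end Gnomonic

section Main

/-- **Euclid XI.21 / the perimeter of a convex spherical polygon is `< 2π`.**  Let
`v 0, …, v (n-1)` (`n ≥ 3`) be vectors of `ℝ³` such that every triple taken in cyclic order is
positively oriented: `det[v i; v j; v k] > 0` for all `i < j < k < n` (equivalently: the rays
`ℝ₊ v i` are the edges, in order, of a convex polyhedral angle with apex `0`; the points
`v i/‖v i‖` are the vertices, in order, of a convex spherical polygon).  Then the plane angles
of the polyhedral angle — the sides of the spherical polygon — add up to less than four right
angles: `Σ_{i<n-1} ∠(v i, v (i+1)) + ∠(v (n-1), v 0) < 2π`. [folklore] -/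
theorem sum_angle_lt_two_pi_of_orient3_pos {n : ℕ} (hn : 3 ≤ n) {v : ℕ → E3}
    (hv : ∀ i j k, i < j → j < k → k < n → 0 < orient3 (v i) (v j) (v k)) :
    ∑ i ∈ range (n - 1), angle (v i) (v (i + 1)) + angle (v (n - 1)) (v 0) < 2 * π := by
  obtain ⟨m, rfl⟩ : ∃ m, n = m + 3 := ⟨n - 3, by omega⟩
  have hsub : m + 3 - 1 = m + 2 := rfl
  rw [hsub]
  -- cyclic reorderings of the hypothesis
  have hcyc : ∀ i j k, i < j → j < k → k < m + 3 → 0 < orient3 (v j) (v k) (v i) := by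
    intro i j k hij hjk hk
    rw [← orient3_cyclic]
    exact hv i j k hij hjk hk
  have hcyc' : ∀ i j k, i < j → j < k → k < m + 3 → 0 < orient3 (v k) (v i) (v j) := by
    intro i j k hij hjk hk
    rw [orient3_cyclic]
    exact hv i j k hij hjk hk
  -- a linear functional positive on all the `v i`
  set φ : E3 →ₗ[ℝ] ℝ := orient3Right (v 0) (v 1) + orient3Right (v 1) (v 2)
    + orient3Right (v (m + 2)) (v 0) with hφdef
  have hφ : ∀ i, i < m + 3 → 0 < φ (v i) := by
    intro i hi
    simp only [hφdef, LinearMap.add_apply, orient3Right_apply]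
    rcases Nat.lt_or_ge i 3 with hi3 | hi3
    · interval_cases i
      · rw [orient3_self_outer, orient3_self_right, zero_add, add_zero]
        exact hcyc 0 1 2 (by omega) (by omega) (by omega)
      · rw [orient3_self_right, orient3_self_outer, zero_add, zero_add]
        exact hcyc' 0 1 (m + 2) (by omega) (by omega) (by omega)
      · rw [orient3_self_right, add_zero]
        refine add_pos_of_pos_of_nonneg (hv 0 1 2 (by omega) (by omega) (by omega)) ?_
        rcases Nat.lt_or_ge 2 (m + 2) with hm | hm
        · exact (hcyc' 0 2 (m + 2) (by omega) hm (by omega)).le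
        · obtain rfl : m = 0 := by omega
          simp
    · refine add_pos_of_pos_of_nonneg (add_pos (hv 0 1 i (by omega) (by omega) hi)
        (hv 1 2 i (by omega) (by omega) hi)) ?_
      rcases Nat.lt_or_ge i (m + 2) with hi' | hi'
      · exact (hcyc' 0 i (m + 2) (by omega) hi' (by omega)).le
      · obtain rfl : i = m + 2 := by omega
        simp
  -- the gnomonic section, extended periodically
  set A : ℕ → E3 := fun i => (φ (v (i % (m + 3))))⁻¹ • v (i % (m + 3)) with hAdef
  have hA : ∀ i, i < m + 3 → A i = (φ (v i))⁻¹ • v i := by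
    intro i hi
    simp only [hAdef, Nat.mod_eq_of_lt hi]
  have hper0 : A (m + 3) = A 0 := by
    simp only [hAdef, Nat.mod_self, Nat.zero_mod]
  have hper1 : A (m + 4) = A 1 := by
    rw [hA 1 (by omega)]
    simp only [hAdef]
    rw [show m + 4 = 1 + (m + 3) by ring, Nat.add_mod_right,
      Nat.mod_eq_of_lt (by omega : 1 < m + 3)]
  have hφA : ∀ i, i < m + 3 → φ (A i) = 1 := by
    intro i hi
    rw [hA i hi, map_smul, smul_eq_mul, inv_mul_cancel₀ (hφ i hi).ne']
  -- pairwise distinct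
  have hne : ∀ i j, i < j → j < m + 3 → A i ≠ A j := by
    intro i j hij hj h
    rw [hA i (by omega), hA j hj] at h
    have h' : v i = (φ (v i) * (φ (v j))⁻¹) • v j := by
      rw [mul_smul, ← h, smul_inv_smul₀ (hφ i (by omega)).ne']
    exact ne_smul_of_orient3_pos (by omega) hv hij hj _ h'
  -- the fan at `A 0`
  have hfan : ∀ k, 2 ≤ k → k ≤ m + 1 →
      A k - A (m + 3) ∈ Submodule.span ℝ≥0 {A 1 - A (m + 3), A (k + 1) - A (m + 3)} := by
    intro k hk hk'
    rw [hper0, hA 0 (by omega), hA 1 (by omega), hA k (by omega), hA (k + 1) (by omega)]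
    exact proj_sub_proj_mem_span φ (hφ 0 (by omega)) (hφ 1 (by omega)) (hφ (k + 1) (by omega))
      (hφ k (by omega)) (hv 0 1 (k + 1) (by omega) (by omega) (by omega))
      (hv 0 k (k + 1) (by omega) (by omega) (by omega)).le
      (hv 0 1 k (by omega) (by omega) (by omega)).le
  -- `A 0` inside every angle `A (k-1), A k, A (k+1)`
  have hmid : ∀ k, 2 ≤ k → k ≤ m + 1 →
      A (m + 3) - A k ∈ Submodule.span ℝ≥0 {A (k - 1) - A k, A (k + 1) - A k} := by
    intro k hk hk'
    rw [Set.pair_comm, hper0, hA 0 (by omega), hA (k - 1) (by omega), hA k (by omega),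
      hA (k + 1) (by omega)]
    refine proj_sub_proj_mem_span φ (hφ k (by omega)) (hφ (k + 1) (by omega))
      (hφ (k - 1) (by omega)) (hφ 0 (by omega)) ?_ ?_ ?_
    · have := hcyc (k - 1) k (k + 1) (by omega) (by omega) (by omega)
      rwa [← orient3_cyclic] at this ⊢
    · exact (hcyc' 0 (k - 1) k (by omega) (by omega) (by omega)).le
    · exact (hcyc 0 k (k + 1) (by omega) (by omega) (by omega)).le
  -- strictness at `A 1`
  have hstrict : ∠ (A 0) (A 1) (A 2) < ∠ (A 0) (A 1) 0 + ∠ 0 (A 1) (A 2) := by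
    refine angle_lt_angle_add_angle_of_orient3 φ (hφA 0 (by omega)) (hφA 1 (by omega))
      (hφA 2 (by omega)) ?_
    rw [hA 0 (by omega), hA 1 (by omega), hA 2 (by omega), orient3_smul_left, orient3_smul_mid,
      orient3_smul_right]
    have := hv 0 1 2 (by omega) (by omega) (by omega)
    have h0 := hφ 0 (by omega); have h1 := hφ 1 (by omega); have h2 := hφ 2 (by omega)
    positivity
  have hcore := sum_angle_lt_two_pi_core A m hper0 hper1 hne hfan hmid hstrict
  -- back to the `v i`
  rw [sum_range_succ, hper0] at hcore
  have hconv : ∀ i j, i < m + 3 → j < m + 3 → angle (A i) (A j) = angle (v i) (v j) := by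
    intro i j hi hj
    rw [hA i hi, hA j hj, angle_smul_left_of_pos _ _ (inv_pos.2 (hφ i hi)),
      angle_smul_right_of_pos _ _ (inv_pos.2 (hφ j hj))]
  rw [hconv (m + 2) 0 (by omega) (by omega),
    sum_congr rfl fun i hi => hconv i (i + 1) (by have := mem_range.1 hi; omega)
      (by have := mem_range.1 hi; omega)] at hcore
  exact hcore

/-- **`Fin n`-indexed form**: for `v : Fin n → ℝ³` (`n ≥ 3`) with all cyclically ordered
triples positively oriented, `Σ_i ∠(v i, v (i+1 mod n)) < 2π`. [folklore] -/
theorem sum_angle_finRotate_lt_two_pi {n : ℕ} (hn : 3 ≤ n) (v : Fin n → E3)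
    (hv : ∀ i j k : Fin n, i < j → j < k → 0 < orient3 (v i) (v j) (v k)) :
    ∑ i : Fin n, angle (v i) (v (finRotate n i)) < 2 * π := by
  obtain ⟨m, rfl⟩ : ∃ m, n = m + 1 := ⟨n - 1, by omega⟩
  set w : ℕ → E3 := fun i => if h : i < m + 1 then v ⟨i, h⟩ else 0 with hw
  have hwi : ∀ i (hi : i < m + 1), w i = v ⟨i, hi⟩ := fun i hi => by simp only [hw, dif_pos hi]
  have h := sum_angle_lt_two_pi_of_orient3_pos hn (v := w) (by
    intro i j k hij hjk hk
    rw [hwi i (by omega), hwi j (by omega), hwi k hk]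
    exact hv _ _ _ (Fin.mk_lt_mk.2 hij) (Fin.mk_lt_mk.2 hjk))
  rw [Nat.add_sub_cancel, hwi m (by omega), hwi 0 (by omega)] at h
  rw [Fin.sum_univ_castSucc, finRotate_last]
  convert h using 2
  · rw [← Fin.sum_univ_eq_sum_range]
    refine Fintype.sum_congr _ _ fun i => ?_
    have h1 : finRotate (m + 1) i.castSucc = ⟨i + 1, by omega⟩ := finRotate_of_lt i.2
    rw [h1, hwi i (by omega), hwi (i + 1) (by omega)]
    rfl
  · rfl

end Main

section Corollaries

/-- The same with the opposite orientation: if every cyclically ordered triple is NEGATIVELY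
oriented (the polygon is traversed clockwise), the perimeter is again `< 2π` (reverse the
order). [folklore] -/
theorem sum_angle_lt_two_pi_of_orient3_neg {n : ℕ} (hn : 3 ≤ n) {v : ℕ → E3}
    (hv : ∀ i j k, i < j → j < k → k < n → orient3 (v i) (v j) (v k) < 0) :
    ∑ i ∈ range (n - 1), angle (v i) (v (i + 1)) + angle (v (n - 1)) (v 0) < 2 * π := by
  have h := sum_angle_lt_two_pi_of_orient3_pos hn (v := fun i => v (n - 1 - i)) (by
    intro i j k hij hjk hk
    rw [orient3_swap_outer]
    exact neg_pos.2 (hv _ _ _ (by omega) (by omega) (by omega)))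
  rw [Nat.sub_self, Nat.sub_zero, angle_comm (v 0)] at h
  convert h using 2
  rw [← sum_range_reflect]
  refine sum_congr rfl fun i hi => ?_
  rw [mem_range] at hi
  rw [angle_comm, show n - 1 - (i + 1) = n - 1 - 1 - i by omega,
    show n - 1 - i = n - 1 - 1 - i + 1 by omega]

/-- **Perimeter bound with a lower bound on the sides.**  If moreover every side is `≥ d`
(e.g. the polygon is equilateral with side `d`), then `n · d < 2π`. [folklore] -/
theorem card_mul_lt_two_pi_of_le_angle {n : ℕ} (hn : 3 ≤ n) {v : ℕ → E3}
    (hv : ∀ i j k, i < j → j < k → k < n → 0 < orient3 (v i) (v j) (v k)) {d : ℝ}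
    (hd : ∀ i, i + 1 < n → d ≤ angle (v i) (v (i + 1))) (hd' : d ≤ angle (v (n - 1)) (v 0)) :
    n * d < 2 * π := by
  have h := sum_angle_lt_two_pi_of_orient3_pos hn hv
  have hs : (n - 1 : ℕ) * d ≤ ∑ i ∈ range (n - 1), angle (v i) (v (i + 1)) := by
    have : ∑ i ∈ range (n - 1), d ≤ ∑ i ∈ range (n - 1), angle (v i) (v (i + 1)) :=
      sum_le_sum fun i hi => hd i (by have := mem_range.1 hi; omega)
    simpa using this
  have hcast : ((n - 1 : ℕ) : ℝ) = n - 1 := by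
    rw [Nat.cast_sub (by omega)]; simp
  rw [hcast] at hs
  nlinarith

/-- Hence `n < 2π/d` for `d > 0` … [folklore] -/
theorem card_lt_two_pi_div_of_le_angle {n : ℕ} (hn : 3 ≤ n) {v : ℕ → E3}
    (hv : ∀ i j k, i < j → j < k → k < n → 0 < orient3 (v i) (v j) (v k)) {d : ℝ} (hd0 : 0 < d)
    (hd : ∀ i, i + 1 < n → d ≤ angle (v i) (v (i + 1))) (hd' : d ≤ angle (v (n - 1)) (v 0)) :
    (n : ℝ) < 2 * π / d := by
  rw [lt_div_iff₀ hd0]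
  exact card_mul_lt_two_pi_of_le_angle hn hv hd hd'

/-- … and **`n ≤ ⌊2π/d⌋`: a convex spherical polygon with all sides `≥ d` has at most `⌊2π/d⌋`
vertices** — the numerical content of Musin–Tarasov's Proposition 3.4 ("If the graph `CG(X)`
is irreducible, then its faces are polygons with at most `⌊2π/d_N⌋` vertices": the faces of an
irreducible contact graph are convex spherical polygons all of whose sides have length
`d_N = ψ(X)`). [cite: MusinTarasov2012, Proposition 3.4] -/
theorem card_le_floor_two_pi_div_of_le_angle {n : ℕ} (hn : 3 ≤ n) {v : ℕ → E3}
    (hv : ∀ i j k, i < j → j < k → k < n → 0 < orient3 (v i) (v j) (v k)) {d : ℝ} (hd0 : 0 < d)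
    (hd : ∀ i, i + 1 < n → d ≤ angle (v i) (v (i + 1))) (hd' : d ≤ angle (v (n - 1)) (v 0)) :
    n ≤ ⌊2 * π / d⌋₊ :=
  Nat.le_floor (card_lt_two_pi_div_of_le_angle hn hv hd0 hd hd').le

/-- In the range of the thirteen-spheres problem (`d > 2π/7`, i.e. `d > 51.43°`; e.g.
`d = d₁₃ ≈ 57.1367°`): **a convex spherical polygon with sides `≥ d` has at most six vertices**
("Polygons with more than six vertices cannot occur", Musin–Tarasov §3.2).
[cite: MusinTarasov2012, Proposition 3.4 and Corollary 3.1 (iii)] -/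
theorem card_le_six_of_le_angle {n : ℕ} (hn : 3 ≤ n) {v : ℕ → E3}
    (hv : ∀ i j k, i < j → j < k → k < n → 0 < orient3 (v i) (v j) (v k)) {d : ℝ}
    (hd7 : 2 * π / 7 < d) (hd : ∀ i, i + 1 < n → d ≤ angle (v i) (v (i + 1)))
    (hd' : d ≤ angle (v (n - 1)) (v 0)) : n ≤ 6 := by
  have h := card_mul_lt_two_pi_of_le_angle hn hv hd hd'
  have hn' : (n : ℝ) < 7 := by
    by_contra! hcon
    have : (7 : ℝ) * (2 * π / 7) ≤ n * d :=
      mul_le_mul hcon hd7.le (by positivity) (by positivity)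
    have h7 : (7 : ℝ) * (2 * π / 7) = 2 * π := by ring
    linarith
  exact_mod_cast Nat.lt_succ_iff.1 (by exact_mod_cast hn' : n < 7)

/-- **Hales's hexagon argument** (proof of Lemma 9 of Hales 2012: "the perimeter of a hexagon
with sides `π/3` is `2π`. However, the hexagons are geodesically convex, and `2π` is a strict
upper bound on the perimeter"): a convex spherical polygon all of whose sides are `≥ π/3` has at
most five vertices; in particular there is no convex spherical hexagon with sides `π/3`.
[cite: Hales2012, Lemma 9 (proof)] -/
theorem card_le_five_of_pi_div_three_le_angle {n : ℕ} (hn : 3 ≤ n) {v : ℕ → E3}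
    (hv : ∀ i j k, i < j → j < k → k < n → 0 < orient3 (v i) (v j) (v k))
    (hd : ∀ i, i + 1 < n → π / 3 ≤ angle (v i) (v (i + 1)))
    (hd' : π / 3 ≤ angle (v (n - 1)) (v 0)) : n ≤ 5 := by
  have h := card_mul_lt_two_pi_of_le_angle hn hv hd hd'
  have hn' : (n : ℝ) < 6 := by nlinarith [Real.pi_pos]
  exact_mod_cast Nat.lt_succ_iff.1 (by exact_mod_cast hn' : n < 6)

end Corollaries

end Literature.Geometry.DiscreteGeometry

end
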